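import Literature.Computability.Complexity.FKPointLocationUntyped
import Literature.Computability.Complexity.CodeFPBudgets
import HarnessLib

/-!
# Fournier–Koiran point location, IX: string codes of the untyped protocol data

Topic `Literature/Computability/Complexity`, grouping namespace `FKPointLocation`. The codes
(`CodeFP` encoders) of untyped tasks, level records, scratch data and states
(`FKPointLocationUntyped.lean`) used by the oracle state machine of Theorem 3: every record is a
RAW LIST OF PRE-ENCODED FIELDS (`rawE strE [field₁, …, field_k]`), read by `rawGetD` at a constant
index (`CodeFP.field`) and built by `rawCons` (`CodeFP.consS`); vectors of integers are raw lists of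
`intE` numerals (`vecE`), options are raw lists of length `≤ 1` (`optE`), tasks are a tag and an
argument list (`taskE`). Plus the generic transfer of a `CodeFP` statement along a view of the
input code (`CodeFP.ofView`) and the length identities of the codes.

## References

* S. Arora, B. Barak, *Computational Complexity: A Modern Approach*, CUP 2009, §0.1 (codes of
  tuples and lists), §1.3. [AroraBarak2009]
* H. Fournier, P. Koiran, *Lower bounds are not easier over the reals: inside PH*, ICALP 2000,
  LNCS 1853 = LIP RR-1999-21, §2.2 (all the data of the location procedure have polynomial size).
  [FournierKoiran2000]
-/

namespace Literature.Computability.Complexity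

open _root_.Computability CodeFP

/-! ### Generic: views, fields, record building -/

namespace CodeFP

variable {α β γ : Type} {eα : α → List Bool} {eβ : β → List Bool} {eγ : γ → List Bool}

/-- **Transfer along a view of the input code**: if `eα a = eγ (t a)` then a map computed on
`eγ`-codes is computed on `eα`-codes after `t`. [folklore] -/
theorem ofView {t : α → γ} (ht : ∀ a, eα a = eγ (t a)) {g : γ → β} (h : CodeFP eγ eβ g) :
    CodeFP eα eβ (fun a => g (t a)) := by
  obtain ⟨f, hf, hfg⟩ := h
  exact ⟨f, hf, fun a => by rw [ht, hfg]⟩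

/-- **Reading field `k` of a record coded as a raw list of pre-encoded fields.** [cite: AroraBarak2009, §1.3] -/
theorem field {fields : α → List (List Bool)} (ht : ∀ a, eα a = rawE strE (fields a)) (k : ℕ) :
    CodeFP eα strE (fun a => (fields a).getD k []) :=
  ((rawGetD strE (d := ([] : List Bool)) rfl).comp
    ((ofView (eγ := rawE strE) ht (CodeFP.id _)).pair (const eα k))).congr fun _ => rfl

/-- The empty record. [folklore] -/
theorem nilS (eα : α → List Bool) : CodeFP eα (rawE strE) (fun _ => ([] : List (List Bool))) := const eα []

/-- Adding a computed field in front of a computed record. [folklore] -/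
theorem consS {g : α → List Bool} {gs : α → List (List Bool)} (h : CodeFP eα strE g)
    (hs : CodeFP eα (rawE strE) gs) : CodeFP eα (rawE strE) (fun a => g a :: gs a) :=
  (rawCons strE).comp (h.pair hs)

/-- Re-reading the output code: a map into pre-encoded strings `eβ ∘ g` is a map into `β`. [folklore] -/
theorem toStrE {g : α → β} (h : CodeFP eα strE (fun a => eβ (g a))) : CodeFP eα eβ g := by
  obtain ⟨f, hf, hfg⟩ := h; exact ⟨f, hf, hfg⟩

/-- A map into `β` is a map into the pre-encoded strings. [folklore] -/
theorem ofStrE {g : α → β} (h : CodeFP eα eβ g) : CodeFP eα strE (fun a => eβ (g a)) := by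
  obtain ⟨f, hf, hfg⟩ := h; exact ⟨f, hf, hfg⟩

/-- Re-reading the input code as a pre-encoded string. [folklore] -/
theorem onStrE {g : α → β} (h : CodeFP eα eβ g) {s : γ → List Bool} {t : γ → α} (hs : ∀ c, s c = eα (t c)) :
    CodeFP s eβ (fun c => g (t c)) := ofView hs h

end CodeFP

namespace FKPointLocation

/-! ### The encoders -/

/-- Integer vectors: raw lists of `intE` numerals. [folklore] -/
abbrev vecE : List ℤ → List Bool := rawE intE

/-- Options as raw lists of length `≤ 1`. [folklore] -/
def optE {α : Type} (e : α → List Bool) : Option α → List Bool := fun o => rawE e o.toList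

/-- `optE` values. [folklore] -/
@[simp] theorem optE_none {α : Type} (e : α → List Bool) : optE e none = [] := rfl
/-- `optE` of `some`. [folklore] -/
@[simp] theorem optE_some {α : Type} (e : α → List Bool) (a : α) : optE e (some a) = rawE e [a] := rfl

/-- The tag of a task. [folklore] -/
def UTask.tag : UTask → ℕ
  | bs _ _ => 0
  | ex _ _ => 1
  | pf _ _ _ => 2
  | st _ => 3
  | ap _ => 4
  | eqGe _ => 5
  | eqLe _ => 6
  | fa _ => 7
  | close => 8
  | fin => 9

/-- The arguments of a task. [folklore] -/
def UTask.args : UTask → List ℕ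
  | bs i k => [i, k]
  | ex sc m => [sc, m]
  | pf sc m w => [sc, m, w]
  | st sc => [sc]
  | ap w => [w]
  | eqGe i => [i]
  | eqLe i => [i]
  | fa i => [i]
  | close => []
  | fin => []

/-- A task is determined by its tag and arguments. [folklore] -/
theorem UTask.ext_tag_args {τ τ' : UTask} (h1 : τ.tag = τ'.tag) (h2 : τ.args = τ'.args) : τ = τ' := by
  cases τ <;> cases τ' <;> simp_all [UTask.tag, UTask.args]

/-- The code of a task: tag and argument list. [folklore] -/
def taskE : UTask → List Bool := fun τ => pairE natE (rawE natE) (τ.tag, τ.args)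

/-- `taskE` is injective. [folklore] -/
theorem taskE_injective : Function.Injective taskE := by
  intro τ τ' h
  have := pairE_injective natE_injective (rawE_injective natE_injective) h
  simp only [Prod.mk.injEq] at this
  exact UTask.ext_tag_args this.1 this.2

/-- The fields of a level record. [folklore] -/
def lrecFields (r : ULevelRec) : List (List Bool) :=
  [vecE r.m, natE r.sc, vecE r.apexN, natE r.apexD, natE r.istar, intE r.εstar]

/-- The code of a level record. [folklore] -/
def lrecE : ULevelRec → List Bool := fun r => rawE strE (lrecFields r)

/-- The fields of a scratch (the stable pair is laid out as two fields). [folklore] -/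
def scrFields (c : UScratch) : List (List Bool) :=
  [vecE c.m, natE c.bsAcc, rawE vecE c.chain, bitE c.exOk, c.bits, optE natE (c.stable.map Prod.fst),
    rawE vecE ((c.stable.map Prod.snd).getD []), vecE c.apexN, natE c.apexD, rawE bitE c.ge, rawE bitE c.le,
    optE natE c.cand]

/-- The code of a scratch. [folklore] -/
def scrE : UScratch → List Bool := fun c => rawE strE (scrFields c)

/-- The fields of a state. [folklore] -/
def dataFields (d : UData) : List (List Bool) := [bitE d.done, bitE d.out, vecE d.chart, rawE lrecE d.levels, scrE d.cur]

/-- **The code of an untyped state.** [cite: FournierKoiran2000, §2.2] -/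
def dataE : UData → List Bool := fun d => rawE strE (dataFields d)

/-! ### Field readers -/

section Readers

/-- Fields of a level record. [folklore] -/
theorem lrec_m : CodeFP lrecE vecE ULevelRec.m := toStrE ((field (fields := lrecFields) (fun _ => rfl) 0).congr fun _ => rfl)
/-- Field reader `lrec_sc` on codes. [folklore] -/
theorem lrec_sc : CodeFP lrecE natE ULevelRec.sc := toStrE ((field (fields := lrecFields) (fun _ => rfl) 1).congr fun _ => rfl)
/-- Field reader `lrec_apexN` on codes. [folklore] -/
theorem lrec_apexN : CodeFP lrecE vecE ULevelRec.apexN := toStrE ((field (fields := lrecFields) (fun _ => rfl) 2).congr fun _ => rfl)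
/-- Field reader `lrec_apexD` on codes. [folklore] -/
theorem lrec_apexD : CodeFP lrecE natE ULevelRec.apexD := toStrE ((field (fields := lrecFields) (fun _ => rfl) 3).congr fun _ => rfl)
/-- Field reader `lrec_istar` on codes. [folklore] -/
theorem lrec_istar : CodeFP lrecE natE ULevelRec.istar := toStrE ((field (fields := lrecFields) (fun _ => rfl) 4).congr fun _ => rfl)
/-- Field reader `lrec_εstar` on codes. [folklore] -/
theorem lrec_εstar : CodeFP lrecE intE ULevelRec.εstar := toStrE ((field (fields := lrecFields) (fun _ => rfl) 5).congr fun _ => rfl)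

/-- Building a level record from computed fields. [folklore] -/
theorem lrec_mk {α : Type} {eα : α → List Bool} {m : α → List ℤ} {sc : α → ℕ} {aN : α → List ℤ} {aD : α → ℕ}
    {ist : α → ℕ} {ε : α → ℤ} (hm : CodeFP eα vecE m) (hsc : CodeFP eα natE sc) (haN : CodeFP eα vecE aN)
    (haD : CodeFP eα natE aD) (hist : CodeFP eα natE ist) (hε : CodeFP eα intE ε) :
    CodeFP eα lrecE (fun a => ⟨m a, sc a, aN a, aD a, ist a, ε a⟩) :=
  toStrE (eβ := lrecE) ((consS (ofStrE hm) (consS (ofStrE hsc) (consS (ofStrE haN) (consS (ofStrE haD)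
    (consS (ofStrE hist) (consS (ofStrE hε) (nilS eα))))))).congr fun _ => rfl)

/-- Fields of a scratch. [folklore] -/
theorem scr_m : CodeFP scrE vecE UScratch.m := toStrE ((field (fields := scrFields) (fun _ => rfl) 0).congr fun _ => rfl)
/-- Field reader `scr_bsAcc` on codes. [folklore] -/
theorem scr_bsAcc : CodeFP scrE natE UScratch.bsAcc := toStrE ((field (fields := scrFields) (fun _ => rfl) 1).congr fun _ => rfl)
/-- Field reader `scr_chain` on codes. [folklore] -/
theorem scr_chain : CodeFP scrE (rawE vecE) UScratch.chain := toStrE ((field (fields := scrFields) (fun _ => rfl) 2).congr fun _ => rfl)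
/-- Field reader `scr_exOk` on codes. [folklore] -/
theorem scr_exOk : CodeFP scrE bitE UScratch.exOk := toStrE ((field (fields := scrFields) (fun _ => rfl) 3).congr fun _ => rfl)
/-- Field reader `scr_bits` on codes. [folklore] -/
theorem scr_bits : CodeFP scrE strE UScratch.bits := (field (fields := scrFields) (fun _ => rfl) 4).congr fun _ => rfl
/-- Field reader `scr_stSc` on codes. [folklore] -/
theorem scr_stSc : CodeFP scrE (optE natE) (fun c => c.stable.map Prod.fst) :=
  toStrE ((field (fields := scrFields) (fun _ => rfl) 5).congr fun _ => rfl)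
/-- Field reader `scr_stChain` on codes. [folklore] -/
theorem scr_stChain : CodeFP scrE (rawE vecE) (fun c => (c.stable.map Prod.snd).getD []) :=
  toStrE ((field (fields := scrFields) (fun _ => rfl) 6).congr fun _ => rfl)
/-- Field reader `scr_apexN` on codes. [folklore] -/
theorem scr_apexN : CodeFP scrE vecE UScratch.apexN := toStrE ((field (fields := scrFields) (fun _ => rfl) 7).congr fun _ => rfl)
/-- Field reader `scr_apexD` on codes. [folklore] -/
theorem scr_apexD : CodeFP scrE natE UScratch.apexD := toStrE ((field (fields := scrFields) (fun _ => rfl) 8).congr fun _ => rfl)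
/-- Field reader `scr_ge` on codes. [folklore] -/
theorem scr_ge : CodeFP scrE (rawE bitE) UScratch.ge := toStrE ((field (fields := scrFields) (fun _ => rfl) 9).congr fun _ => rfl)
/-- Field reader `scr_le` on codes. [folklore] -/
theorem scr_le : CodeFP scrE (rawE bitE) UScratch.le := toStrE ((field (fields := scrFields) (fun _ => rfl) 10).congr fun _ => rfl)
/-- Field reader `scr_cand` on codes. [folklore] -/
theorem scr_cand : CodeFP scrE (optE natE) UScratch.cand := toStrE ((field (fields := scrFields) (fun _ => rfl) 11).congr fun _ => rfl)

/-- The stable pair is determined by its two laid-out fields. [folklore] -/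
theorem stable_eq_of_fields (o : Option (ℕ × List (List ℤ))) :
    o = (o.map Prod.fst).map (fun sc => (sc, (o.map Prod.snd).getD [])) := by
  cases o <;> rfl

/-- Building a scratch from computed fields (the stable pair given by its two fields). [folklore] -/
theorem scr_mk {α : Type} {eα : α → List Bool} {m : α → List ℤ} {acc : α → ℕ} {ch : α → List (List ℤ)}
    {ex : α → Bool} {bits : α → List Bool} {stSc : α → Option ℕ} {stCh : α → List (List ℤ)}
    {aN : α → List ℤ} {aD : α → ℕ} {ge le : α → List Bool} {cand : α → Option ℕ}
    (hm : CodeFP eα vecE m) (hacc : CodeFP eα natE acc) (hch : CodeFP eα (rawE vecE) ch) (hex : CodeFP eα bitE ex)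
    (hbits : CodeFP eα strE bits) (hstSc : CodeFP eα (optE natE) stSc) (hstCh : CodeFP eα (rawE vecE) stCh)
    (haN : CodeFP eα vecE aN) (haD : CodeFP eα natE aD) (hge : CodeFP eα (rawE bitE) ge) (hle : CodeFP eα (rawE bitE) le)
    (hcand : CodeFP eα (optE natE) cand) (hst : ∀ a, stSc a = none → stCh a = []) :
    CodeFP eα scrE (fun a => ⟨m a, acc a, ch a, ex a, bits a, (stSc a).map (fun sc => (sc, stCh a)), aN a, aD a, ge a, le a, cand a⟩) :=
  toStrE (eβ := scrE) ((consS (ofStrE hm) (consS (ofStrE hacc) (consS (ofStrE hch) (consS (ofStrE hex) (consS hbits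
    (consS (ofStrE hstSc) (consS (ofStrE hstCh) (consS (ofStrE haN) (consS (ofStrE haD) (consS (ofStrE hge)
    (consS (ofStrE hle) (consS (ofStrE hcand) (nilS eα))))))))))))).congr fun a => by
      simp only [scrFields, Option.map_map]
      rcases h : stSc a with _ | sc
      · simp [hst a h]
      · rfl)

/-- Fields of a state. [folklore] -/
theorem data_done : CodeFP dataE bitE UData.done := toStrE ((field (fields := dataFields) (fun _ => rfl) 0).congr fun _ => rfl)
/-- Field reader `data_out` on codes. [folklore] -/
theorem data_out : CodeFP dataE bitE UData.out := toStrE ((field (fields := dataFields) (fun _ => rfl) 1).congr fun _ => rfl)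
/-- Field reader `data_chart` on codes. [folklore] -/
theorem data_chart : CodeFP dataE vecE UData.chart := toStrE ((field (fields := dataFields) (fun _ => rfl) 2).congr fun _ => rfl)
/-- Field reader `data_levels` on codes. [folklore] -/
theorem data_levels : CodeFP dataE (rawE lrecE) UData.levels := toStrE ((field (fields := dataFields) (fun _ => rfl) 3).congr fun _ => rfl)
/-- Field reader `data_cur` on codes. [folklore] -/
theorem data_cur : CodeFP dataE scrE UData.cur := toStrE ((field (fields := dataFields) (fun _ => rfl) 4).congr fun _ => rfl)

/-- Building a state from computed fields. [folklore] -/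
theorem data_mk {α : Type} {eα : α → List Bool} {dn out : α → Bool} {chart : α → List ℤ}
    {levels : α → List ULevelRec} {cur : α → UScratch}
    (hdn : CodeFP eα bitE dn) (hout : CodeFP eα bitE out) (hchart : CodeFP eα vecE chart)
    (hlevels : CodeFP eα (rawE lrecE) levels) (hcur : CodeFP eα scrE cur) :
    CodeFP eα dataE (fun a => ⟨dn a, out a, chart a, levels a, cur a⟩) :=
  toStrE (eβ := dataE) ((consS (ofStrE hdn) (consS (ofStrE hout) (consS (ofStrE hchart) (consS (ofStrE hlevels)
    (consS (ofStrE hcur) (nilS eα)))))).congr fun _ => rfl)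

/-- Tag and arguments of a task. [folklore] -/
theorem task_tag : CodeFP taskE natE UTask.tag := ofView (eγ := pairE natE (rawE natE)) (fun _ => rfl) (fst _ _)
/-- Field reader `task_args` on codes. [folklore] -/
theorem task_args : CodeFP taskE (rawE natE) UTask.args := ofView (eγ := pairE natE (rawE natE)) (fun _ => rfl) (snd _ _)

/-- Argument `j` of a task (default `0`). [folklore] -/
theorem task_arg (j : ℕ) : CodeFP taskE natE (fun τ => τ.args.getD j 0) :=
  ((rawGetD natE (d := 0) rfl).comp (task_args.pair (const taskE j))).congr fun _ => rfl

end Readers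

/-! ### Lengths of the codes -/

section Lengths

/-- `|intE z| ≤ 3 size |z| + 2`. [folklore] -/
theorem length_intE_le (z : ℤ) : (intE z).length ≤ 3 * Nat.size z.natAbs + 2 := by
  have h1 : (natE z.toNat).length ≤ Nat.size z.natAbs := by
    rw [length_natE]; exact size_mono (by omega)
  have h2 : (natE (-z).toNat).length ≤ Nat.size z.natAbs := by
    rw [length_natE]; exact size_mono (by omega)
  show (boolPair (encodeNat z.toNat) (encodeNat (-z).toNat)).length ≤ _
  rw [length_boolPair]
  change 2 * (natE z.toNat).length + 2 + (natE (-z).toNat).length ≤ _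
  omega

/-- `size m ≤ k` when `m < 2^k`. [folklore] -/
theorem size_le_of_lt_two_pow {m k : ℕ} (h : m < 2 ^ k) : Nat.size m ≤ k := Nat.size_le.2 h

/-- Length of a raw list with bounded items. [folklore] -/
theorem length_rawE_le_of_forall {α : Type} (e : α → List Bool) {l : List α} {M : ℕ}
    (h : ∀ a ∈ l, (e a).length ≤ M) : (rawE e l).length ≤ l.length * (2 * M + 2) := by
  rw [length_rawE]
  calc (l.map fun a => 2 * (e a).length + 2).sum ≤ (l.map fun _ => 2 * M + 2).sum :=
        List.sum_le_sum (fun a ha => by have := h a ha; omega)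
    _ = l.length * (2 * M + 2) := by rw [List.map_const', List.sum_replicate, smul_eq_mul]

/-- Length of an integer vector with entries `< 2^k` in absolute value. [folklore] -/
theorem length_vecE_le {l : List ℤ} {k : ℕ} (h : ∀ a ∈ l, a.natAbs < 2 ^ k) :
    (vecE l).length ≤ l.length * (6 * k + 6) := by
  have := length_rawE_le_of_forall intE (l := l) (M := 3 * k + 2) fun a ha =>
    (length_intE_le a).trans (by have := size_le_of_lt_two_pow (h a ha); omega)
  calc (vecE l).length ≤ l.length * (2 * (3 * k + 2) + 2) := this
    _ = l.length * (6 * k + 6) := by ring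

/-- Length of a bit list code. [folklore] -/
theorem length_rawE_bitE (l : List Bool) : (rawE bitE l).length = 4 * l.length := by
  rw [length_rawE]
  induction l with
  | nil => rfl
  | cons b l ih => simp [bitE] at ih ⊢; omega

/-- Length of an `optE natE` code with value `< 2^k`. [folklore] -/
theorem length_optE_natE_le {o : Option ℕ} {k : ℕ} (h : ∀ a ∈ o, a < 2 ^ k) : (optE natE o).length ≤ 2 * k + 2 := by
  cases o with
  | none => simp
  | some a =>
    have := size_le_of_lt_two_pow (h a rfl)
    simp only [optE_some, rawE_cons, rawE_nil, length_boolPair, List.length_nil, length_natE]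
    omega

/-- Length of a task code with arguments `< 2^k`. [folklore] -/
theorem length_taskE_le {τ : UTask} {k : ℕ} (h : ∀ a ∈ τ.args, a < 2 ^ k) : (taskE τ).length ≤ 6 * k + 18 := by
  have htag : (natE τ.tag).length ≤ 4 := by
    rw [length_natE]; apply size_le_of_lt_two_pow; cases τ <;> simp [UTask.tag]
  have hlen : τ.args.length ≤ 3 := by cases τ <;> simp [UTask.args]
  have hargs := length_rawE_le_of_forall natE (l := τ.args) (M := k) fun a ha => by
    rw [length_natE]; exact size_le_of_lt_two_pow (h a ha)
  simp only [taskE, pairE_apply, length_boolPair]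
  have : τ.args.length * (2 * k + 2) ≤ 3 * (2 * k + 2) := Nat.mul_le_mul_right _ hlen
  omega

end Lengths

end FKPointLocation

end Literature.Computability.Complexity
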